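import Mathlib
import HarnessLib
import Summits.QuantumAdvantage.QuantumAdvantage.Theorems.PumpDialJ

/-!
# PumpDial K — twist law (3/3): all-live inputs on K-hard boards, base change, `LinearUnityDegree` / `NoUnityHardOdd` / `NoOneLiveHardOdd` PROVED

Lens «minimal-counterexample / extremal reduction» (decomp-qadv-lens-4, generation 26): the TWIST LAW package,
cut into chain-imported parts `PumpDialI → PumpDialJ → PumpDialK` (Theses-free: imports only `PumpDialG`,
`AdviceFreeQNC0.WalkAdaptedFarPattern`, HarnessLib, Mathlib) and the junction `PumpDialL` (imports `PumpDialH`).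
The monolithic file of record (`TwistLaw.lean`, farm rc 0 · 0 sorry · axioms {propext, Classical.choice, Quot.sound})
and the full mathematical header live in the lens folder g26; this part:
`exists_allLive` (every `KHard` board has an all-live alternating input), `unityAt_map` (base change of unities),
`exists_omega_algClosure`, `not_unityAt_of_kHard` (`p ≥ 5`, `3d+3 ≤ n`, `KHard` ⇒ no unity over `ZMod p`), and the g25 ladder closed:
`linearUnityDegree_holds`, `noUnityHardOdd_holds` (B_K), `noUnityEvenOdd_holds`, `noOneLiveHardOdd_holds` (B).
-/

set_option autoImplicit false
set_option linter.dupNamespace false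

namespace Summit.QuantumAdvantage.QuantumAdvantage.Theorems.PumpDial
open Classical
open Finset
open Summit.QuantumAdvantage.AdviceFreeQNC0
open Literature.Computability.MetaComplexity Literature.Computability.MetaComplexity.Smolensky

/-! ## K-hard boards have an all-live input -/
section AllLive

/-- `e_0(u) = |u|`. -/
theorem walkExp_zero_eq_wt {n : ℕ} (u : Fin n → Bool) : walkExp u 0 = wt u := by
  unfold walkExp wtPrefix
  simp

/-- **every K-hard board has an input at which all `n + 1` cuts are live** (the alternating inputs
`0101…` / `1010…`; two-step induction on `n`, prepending a paused pair `b, ¬b`). -/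
theorem exists_allLive : ∀ n c : ℕ, KHard n c →
    ∃ u : Fin n → Bool, ∀ g : Fin (n + 1), (c + g.val + walkExp u g.val) % 3 ≠ 0 := by
  intro n
  induction n using Nat.twoStepInduction with
  | zero =>
    intro c hc
    refine ⟨fun i => i.elim0, fun g => ?_⟩
    have hg : g.val = 0 := by omega
    have hc' : c % 3 ≠ 0 := by
      unfold KHard HardBoard EvenOff at hc; omega
    rw [hg, walkExp_zero_eq_wt]
    unfold wt
    simp only [Finset.univ_eq_empty, Finset.filter_empty, Finset.card_empty, add_zero]
    exact hc'
  | one =>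
    intro c hc
    have hc' : c % 3 = 1 := by
      unfold KHard HardBoard EvenOff at hc; omega
    refine ⟨fun _ => false, fun g => ?_⟩
    have hw : walkExp (fun _ : Fin 1 => false) g.val = 0 := by
      unfold walkExp wt wtPrefix; simp
    rw [hw]
    have hg : g.val < 2 := g.isLt
    omega
  | more n ih _ =>
    intro c hc
    have hc' : KHard n (c + 1) := by
      unfold KHard HardBoard EvenOff at hc ⊢; omega
    obtain ⟨v, hv⟩ := ih (c + 1) hc'
    have hx : (c + 1 + wt v) % 3 ≠ 0 := by
      have := hv 0
      rw [Fin.val_zero, walkExp_zero_eq_wt, add_zero] at this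
      exact this
    -- first bit: `1` iff `c + 1 + |v| ≡ 2`, second bit its negation (a paused pair)
    set b₀ : Bool := decide ((c + 1 + wt v) % 3 = 2) with hb₀def
    have hB : ((c + 1 + wt v) % 3 = 2 → b₀.toNat = 1) ∧ ((c + 1 + wt v) % 3 ≠ 2 → b₀.toNat = 0) := by
      constructor
      · intro h; rw [hb₀def, decide_eq_true h]; rfl
      · intro h; rw [hb₀def, decide_eq_false h]; rfl
    have hBB : b₀.toNat + (!b₀).toNat = 1 := by cases b₀ <;> rfl
    refine ⟨Fin.cons b₀ (Fin.cons (!b₀) v), fun g => ?_⟩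
    obtain ⟨gv, hg⟩ := g
    match gv, hg with
    | 0, _ =>
      show (c + 0 + walkExp (Fin.cons b₀ (Fin.cons (!b₀) v) : Fin (n + 2) → Bool) 0) % 3 ≠ 0
      rw [walkExp_cons_zero, wt_cons]
      omega
    | 1, _ =>
      show (c + 1 + walkExp (Fin.cons b₀ (Fin.cons (!b₀) v) : Fin (n + 2) → Bool) (0 + 1)) % 3 ≠ 0
      rw [walkExp_cons_succ, walkExp_cons_zero]
      omega
    | h + 2, hh =>
      show (c + (h + 1 + 1) + walkExp (Fin.cons b₀ (Fin.cons (!b₀) v) : Fin (n + 2) → Bool) (h + 1 + 1)) % 3 ≠ 0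
      rw [walkExp_cons_succ, walkExp_cons_succ]
      have := hv ⟨h, by omega⟩
      simp only at this
      omega

end AllLive

/-! ## Base change and the law over `ZMod p`, `p ≥ 5` -/
section BaseChange

/-- unities base-change along any ring map of fields. -/
theorem unityAt_map {K L : Type*} [Field K] [Field L] (f : K →+* L) {n c d : ℕ} (h : UnityAt K n c d) :
    UnityAt L n c d := by
  classical
  obtain ⟨Y, hY, hunit⟩ := h
  have key : ∀ Q : CubeFn K n, Q ∈ lowDeg K n d → (fun u => f (Q u)) ∈ lowDeg L n d := by
    intro Q hQ
    rw [lowDeg_eq_span] at hQ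
    induction hQ using Submodule.span_induction with
    | mem Q hQ =>
      obtain ⟨⟨S, hS⟩, rfl⟩ := hQ
      have e : (fun u => f (mono K S u)) = mono L S := by
        funext u
        unfold mono
        rw [map_prod]
        exact Finset.prod_congr rfl fun i _ => by split_ifs <;> simp
      exact e ▸ mono_mem_lowDeg hS
    | zero =>
      have e : (fun u : Fin n → Bool => f ((0 : CubeFn K n) u)) = 0 := by funext u; simp
      rw [e]; exact Submodule.zero_mem _
    | add Q R _ _ hQ hR =>
      have e : (fun u => f ((Q + R) u)) = (fun u => f (Q u)) + (fun u => f (R u)) := by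
        funext u; simp
      rw [e]; exact Submodule.add_mem _ hQ hR
    | smul r Q _ hQ =>
      have e : (fun u => f ((r • Q) u)) = f r • (fun u => f (Q u)) := by
        funext u; simp
      rw [e]; exact Submodule.smul_mem _ _ hQ
  refine ⟨fun g u => f (Y g u), fun g => key _ (hY g), fun u => ?_⟩
  have h := congrArg f (hunit u)
  rw [map_sum, map_one] at h
  rw [← h]
  refine Finset.sum_congr rfl fun g _ => ?_
  rw [map_mul]
  unfold liveInd
  split_ifs <;> simp

/-- a cube root of unity in the algebraic closure of `ZMod p`. -/
theorem exists_omega_algClosure (p : ℕ) [Fact p.Prime] :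
    ∃ ω : AlgebraicClosure (ZMod p), ω ^ 2 + ω + 1 = 0 := by
  have hdeg : (Polynomial.X ^ 2 + Polynomial.X + 1 : Polynomial (AlgebraicClosure (ZMod p))).degree ≠ 0 := by
    have : (Polynomial.X ^ 2 + Polynomial.X + 1 : Polynomial (AlgebraicClosure (ZMod p))).degree = 2 := by
      compute_degree!
    rw [this]; decide
  obtain ⟨x, hx⟩ := IsAlgClosed.exists_root _ hdeg
  refine ⟨x, ?_⟩
  have := hx
  simp only [Polynomial.IsRoot, Polynomial.eval_add, Polynomial.eval_pow, Polynomial.eval_X,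
    Polynomial.eval_one] at this
  exact this

/-- **THE TWIST LAW over `ZMod p`, `p ≥ 5`**: no unity of degree `d` on a K-hard board with `3d + 3 ≤ n`. -/
theorem not_unityAt_of_kHard {p : ℕ} [Fact p.Prime] (hp : 5 ≤ p) {n c d : ℕ} (hn : 3 * d + 3 ≤ n)
    (hK : KHard n c) : ¬ UnityAt (ZMod p) n c d := by
  intro hU
  have hU' : UnityAt (AlgebraicClosure (ZMod p)) n c d :=
    unityAt_map (algebraMap (ZMod p) (AlgebraicClosure (ZMod p))) hU
  obtain ⟨ω, hω⟩ := exists_omega_algClosure p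
  have h3 : (3 : AlgebraicClosure (ZMod p)) ≠ 0 := by
    have e : ((3 : ℕ) : AlgebraicClosure (ZMod p)) =
        algebraMap (ZMod p) (AlgebraicClosure (ZMod p)) ((3 : ℕ) : ZMod p) := (map_natCast _ 3).symm
    have h3' : ((3 : ℕ) : ZMod p) ≠ 0 := by exact_mod_cast three_ne_zero_zmod hp
    rw [show (3 : AlgebraicClosure (ZMod p)) = ((3 : ℕ) : AlgebraicClosure (ZMod p)) by norm_num, e]
    exact (map_ne_zero _).2 h3'
  obtain ⟨u₀, hu₀⟩ := exists_allLive n c hK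
  exact not_unityAt_of_allLive hω h3 hn hu₀ hU'

/-- degree form: on a K-hard board the unity degree is at least `⌊n/3⌋` (no unity of degree `⌊n/3⌋ − 1`). -/
theorem not_unityAt_third {p : ℕ} [Fact p.Prime] (hp : 5 ≤ p) {n c : ℕ} (hn : 3 ≤ n) (hK : KHard n c) :
    ¬ UnityAt (ZMod p) n c (n / 3 - 1) :=
  not_unityAt_of_kHard hp (by omega) hK

/-- **`LinearUnityDegree` is a theorem** (g25's open rung `LUD`; no BASE, no PUMP needed). -/
theorem linearUnityDegree_holds : LinearUnityDegree := by
  intro p _ hp n c hn hK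
  exact not_unityAt_of_kHard hp (by omega) hK

/-- **B_K = `NoUnityHardOdd` is a theorem**: no K-linear unity of polylog degree on hard boards, `p ≥ 5`. -/
theorem noUnityHardOdd_holds : NoUnityHardOdd := closes_K_of_lud linearUnityDegree_holds

/-- the even off-diagonal class as well. -/
theorem noUnityEvenOdd_holds : NoUnityEvenOdd := fun p _ hp => noUnityEven_of_lud (linearUnityDegree_holds p hp)

/-- **B = `NoOneLiveHardOdd` is a theorem**: no Boolean polylog-degree strategy fires exactly one live cut at
every input of a hard board, `p ≥ 5`. -/
theorem noOneLiveHardOdd_holds : NoOneLiveHardOdd := bK_imp_b noUnityHardOdd_holds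

end BaseChange

end Summit.QuantumAdvantage.QuantumAdvantage.Theorems.PumpDial
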